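import Summits.MatrixMultiplication.MatrixMultiplication.Theorems.SaturationLadderGaugeCone
import Summits.MatrixMultiplication.MatrixMultiplication.Theorems.SaturationLadderHullCeiling
import Summits.MatrixMultiplication.MatrixMultiplication.Theorems.SaturationLadderTwinCeiling
import Summits.MatrixMultiplication.MatrixMultiplication.Theorems.SaturationLadderTransferLawItems
import HarnessLib

/-!
# Route `SaturationLadder` — every certificate class of the tree in ONE gauge cone: the in-class saturation constant of
the full format algebra is the class ceiling `c₂ = (5 log(5/4) + 3 log 2)/3 = log 2.90099…`, two-sided
(decomp-mm lens 1 «grading / quantitative ladder», gen 29; companion of the route-free `…GaugeCone`)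

Crux `SubexpSaturation` (stmt-MatrixMultiplication-25909).  §1 RUNG SIDE in clause currency: `Base(θ) ⟹ clause(c)` for all
`c > log θ`; with the pencil frontier `base_of_cube_gt` (gen 14) the clause is a THEOREM for every `c > c₂`, and
`SubexpSaturation ⟺ ∀ c ∈ (0,c₂], clause(c)`.  §2 THE TWIN CLASS (Z-perfect STAGE-2 designs, hypotheses of
`omegaRect_one_tw_exact` verbatim; critic g28 r3(b)) lies in the cone `G_{c₂−ε, μ(ε)}` for every `0 < ε < c₂`
(`twin_uniform_ceiling`, gen 13, through the dictionary `gauge_of_ceiling` / `gauge_of_small_t`).  §3 THE LANDED TWIN FAMILY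
has gauge slope EXACTLY `(47/30) log 2 = log θ_F`: inside `G_{(47/30) log 2, μ}` for all `μ ≥ 0`, outside `G_{λ,μ}` eventually
for every `λ > (47/30) log 2` — in particular outside gen 28's floor `F = G_{log 4, 1 − log 2}` (gen 28's class `𝒞` was the
`log 4`-stratum only).  §4 X-perfect and near-square formats lie in every `G_{λ,μ}`, `λ ≤ log 4`, `μ ≥ 1 − log 2`.
§5 HEADLINE `treeClasses_constant`: above `c₂` the clause is a theorem; for `0 < c < c₂` ONE cone `G_{(c+c₂)/2, μ}` — closed
under Kronecker sums, scalings, exact and small-defect single-base transfers (`gauge_add`, `gauge_smul`, `gauge_transfer`,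
`gauge_of_smallDefect`) — contains the twin class, the X-perfect catalogue and the near-square family and has no witness at
rate `c` beyond an explicit `t₀ < 1`.  Below `c₂` a class outside every cone of positive slope is needed (cell model optimum
`c⋆ = 1.0645958`, instrument only).  0 sorry; no definitions; no named facts as hypotheses.
[cite: CoppersmithWinograd1990, §8 (pp. 268–269); AlmanDuanVassilevskaWilliamsXuXuZhou2025, Thm. 3.2 and §3.4;
LottiRomani1983, §1 (p. 173); ChristandlLeGallLysikovZuiddam2020, Thm. 3.10 and Lemma 4.1]
-/

set_option linter.dupNamespace false

noncomputable section

namespace Summit.MatrixMultiplication.MatrixMultiplication.Theorems.SaturationLadderGaugeConeClasses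

open Literature.Computability.AlgebraicComplexity
open Summit.MatrixMultiplication.MatrixMultiplication.Theses.SaturationLadder (SubexpSaturation)
open Summit.MatrixMultiplication.MatrixMultiplication.Theorems.SaturationLadderGaugeCone (gauge_of_ceiling gauge_of_small_t gauge_of_lengthFloor gaugeClass_excludes_subexp_witness)
open Summit.MatrixMultiplication.MatrixMultiplication.Theorems.SaturationLadderHullCeiling (twin_uniform_ceiling)
open Summit.MatrixMultiplication.MatrixMultiplication.Theorems.SaturationLadderTwinMember (member_t_le_one)
open Summit.MatrixMultiplication.MatrixMultiplication.Theorems.SaturationLadderTwinCeiling (base_of_cube_gt)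
open Summit.MatrixMultiplication.MatrixMultiplication.Theorems.SaturationLadderBaseFamily (rpow_inv_eq_exp)
open Summit.MatrixMultiplication.MatrixMultiplication.Theorems.SaturationLadderTwinFamily
open Summit.MatrixMultiplication.MatrixMultiplication.Theorems.SaturationLadderFamilyConstant (nat_le_family_exponent)
open Summit.MatrixMultiplication.MatrixMultiplication.Theorems.SaturationLadderTransferLawItems (xPerfect_lengthFloor)
open Summit.MatrixMultiplication.MatrixMultiplication.Theorems.SaturationLadderLengthFloorCone (lengthFloor_nearSquare)

/-! ## 1. The rung side in clause currency -/

/-- **`Base(θ) ⟹ clause(c)` for every `c > log θ`**: the constant `C` is absorbed by `e^{(c − log θ)/(1−t)}` beyond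
`t₀ = max(0, 1 − (c − log θ)/max(log C, 1))`. [folklore] -/
theorem clause_of_base {θ C : ℝ} (hθ : 1 < θ)
    (hB : ∀ t : ℝ, 0 ≤ t → t < 1 → ∃ r : ℝ, 1 ≤ r ∧ r ≤ C * θ ^ (1 / (1 - t)) ∧ omegaRect ℂ 1 t r ≤ 1 + r)
    (c : ℝ) (hc : Real.log θ < c) :
    ∃ t₀ : ℝ, t₀ < 1 ∧ ∀ t : ℝ, t₀ ≤ t → t < 1 →
      ∃ r : ℝ, 1 ≤ r ∧ r ≤ Real.exp (c / (1 - t)) ∧ omegaRect ℂ 1 t r ≤ 1 + r := by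
  have hθ0 : 0 < θ := by linarith
  set g : ℝ := c - Real.log θ with hg
  have hg0 : 0 < g := by rw [hg]; linarith
  set M : ℝ := max (Real.log C) 1 with hM
  have hM1 : 1 ≤ M := le_max_right _ _
  have hM0 : 0 < M := by linarith
  refine ⟨max 0 (1 - g / M), max_lt one_pos (by have : 0 < g / M := div_pos hg0 hM0; linarith), ?_⟩
  intro t ht₀ ht1
  have ht0 : 0 ≤ t := le_trans (le_max_left _ _) ht₀
  have hs : 0 < 1 - t := by linarith
  obtain ⟨r, hr1, hr, hcert⟩ := hB t ht0 ht1
  refine ⟨r, hr1, hr.trans ?_, hcert⟩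
  rw [rpow_inv_eq_exp hθ0]
  have hsplit : Real.exp (c / (1 - t)) = Real.exp (g / (1 - t)) * Real.exp (Real.log θ / (1 - t)) := by
    rw [← Real.exp_add]; congr 1; rw [hg]; field_simp; ring
  rw [hsplit]
  refine mul_le_mul_of_nonneg_right ?_ (Real.exp_pos _).le
  rcases le_or_gt C 1 with hC1 | hC1
  · exact hC1.trans (Real.one_le_exp (by positivity))
  · have hlogC : Real.log C ≤ M := le_max_left _ _
    have h1t : 1 - t ≤ g / M := by linarith [le_trans (le_max_right _ _) ht₀]
    have hMle : M ≤ g / (1 - t) := by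
      rw [le_div_iff₀ hs]
      calc M * (1 - t) ≤ M * (g / M) := mul_le_mul_of_nonneg_left h1t hM0.le
        _ = g := by field_simp
    calc C = Real.exp (Real.log C) := (Real.exp_log (by linarith)).symm
      _ ≤ Real.exp (g / (1 - t)) := Real.exp_le_exp.2 (hlogC.trans hMle)

/-- `3 c₂ = log(3125/128)`: `e^{3c₂} = (5/4)^5 · 2^3`. [folklore] -/
theorem three_classCeiling_eq : 5 * Real.log (5 / 4) + 3 * Real.log 2 = Real.log (3125 / 128) := by
  rw [show (3125 : ℝ) / 128 = (5 / 4) ^ 5 * 2 ^ 3 by norm_num, Real.log_mul (by norm_num) (by norm_num),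
    Real.log_pow, Real.log_pow]
  push_cast; ring

/-- `0 < c₂`. [folklore] -/
theorem classCeiling_pos : 0 < (5 * Real.log (5 / 4) + 3 * Real.log 2) / 3 := by
  have h1 : 0 < Real.log (5 / 4) := Real.log_pos (by norm_num)
  have h2 : 0 < Real.log 2 := Real.log_pos (by norm_num)
  positivity

/-- **The `SubexpSaturation` clause is a theorem for every rate `c > c₂ = (5 log(5/4) + 3 log 2)/3`** (base
`θ = e^{(c+c₂)/2}` has `θ³ > 3125/128`, so `Base(θ)` by the pencil frontier `base_of_cube_gt`, and `log θ < c`).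
[cite: CoppersmithWinograd1990, §8 (pp. 268–269); AlmanDuanVassilevskaWilliamsXuXuZhou2025, Thm. 3.2 and §3.4] -/
theorem clause_above_classCeiling (c : ℝ) (hc : (5 * Real.log (5 / 4) + 3 * Real.log 2) / 3 < c) :
    ∃ t₀ : ℝ, t₀ < 1 ∧ ∀ t : ℝ, t₀ ≤ t → t < 1 →
      ∃ r : ℝ, 1 ≤ r ∧ r ≤ Real.exp (c / (1 - t)) ∧ omegaRect ℂ 1 t r ≤ 1 + r := by
  set c₂ : ℝ := (5 * Real.log (5 / 4) + 3 * Real.log 2) / 3 with hc₂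
  have hc₂0 : 0 < c₂ := classCeiling_pos
  set θ : ℝ := Real.exp ((c + c₂) / 2) with hθ
  have hθ1 : 1 < θ := by rw [hθ, ← Real.exp_zero]; exact Real.exp_lt_exp.2 (by linarith)
  have hcube : (3125 : ℝ) / 128 < θ ^ 3 := by
    have e3 : θ ^ 3 = Real.exp (3 * ((c + c₂) / 2)) := by
      rw [hθ, ← Real.exp_nat_mul]; push_cast; ring_nf
    have e2 : (3125 : ℝ) / 128 = Real.exp (3 * c₂) := by
      rw [hc₂, show 3 * ((5 * Real.log (5 / 4) + 3 * Real.log 2) / 3) = 5 * Real.log (5 / 4) + 3 * Real.log 2 by ring,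
        three_classCeiling_eq, Real.exp_log (by norm_num)]
    rw [e3, e2]
    exact Real.exp_lt_exp.2 (by linarith)
  obtain ⟨C, hB⟩ := base_of_cube_gt (Real.exp_pos _) hcube
  exact clause_of_base hθ1 hB c (by rw [hθ, Real.log_exp]; linarith)

/-- **The open content of the crux in clause currency**: `SubexpSaturation ⟺ ∀ c ∈ (0, c₂], clause(c)`.
[cite: AlmanDuanVassilevskaWilliamsXuXuZhou2025, §3.4] -/
theorem subexpSaturation_iff_clause_le_classCeiling :
    SubexpSaturation ↔ ∀ c : ℝ, 0 < c → c ≤ (5 * Real.log (5 / 4) + 3 * Real.log 2) / 3 →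
      ∃ t₀ : ℝ, t₀ < 1 ∧ ∀ t : ℝ, t₀ ≤ t → t < 1 →
        ∃ r : ℝ, 1 ≤ r ∧ r ≤ Real.exp (c / (1 - t)) ∧ omegaRect ℂ 1 t r ≤ 1 + r :=
  ⟨fun h c hc _ => h c hc, fun h c hc =>
    (le_or_gt c ((5 * Real.log (5 / 4) + 3 * Real.log 2) / 3)).elim (fun hle => h c hc hle)
      (fun hlt => clause_above_classCeiling c hlt)⟩

/-! ## 2. The twin class lies in the gauge cone `G_{c₂−ε, μ(ε)}` -/

/-- **The twin class in one gauge cone.**  For every `0 < ε < c₂` there is `μ ≥ 0` such that every STAGE-2 twin design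
(hypotheses of `omegaRect_one_tw_exact` verbatim) of positive thinness `t` has `t < 1` and
`(c₂−ε)·t/(1−t) ≤ log((1+r)/t) + μ`, i.e. its format `(1,t,r)` lies in `G_{c₂−ε,μ}`.
[cite: CoppersmithWinograd1990, §8 (pp. 268–269); AlmanDuanVassilevskaWilliamsXuXuZhou2025, §3.4] -/
theorem twinClass_gauge (ε : ℝ) (hε : 0 < ε) (hεc : ε < (5 * Real.log (5 / 4) + 3 * Real.log 2) / 3) :
    ∃ μ : ℝ, 0 ≤ μ ∧ ∀ (j n₁ n₂ n₃ n₄ n₅ n₆ : ℕ), 0 < n₆ → n₁ + n₄ + n₅ = 2 * n₆ →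
      n₂ + n₃ = 2 ^ (j + 1) * n₆ →
      shannonEntropy ![((n₁ : ℝ) + n₄ + n₅) / (n₁ + n₂ + n₃ + n₄ + n₅ + n₆ : ℕ),
            ((n₂ : ℝ) + n₃) / (n₁ + n₂ + n₃ + n₄ + n₅ + n₆ : ℕ),
            (n₆ : ℝ) / (n₁ + n₂ + n₃ + n₄ + n₅ + n₆ : ℕ)] ≤
          shannonEntropy ![((n₂ : ℝ) + n₄ + n₆) / (n₁ + n₂ + n₃ + n₄ + n₅ + n₆ : ℕ),
            ((n₁ : ℝ) + n₃) / (n₁ + n₂ + n₃ + n₄ + n₅ + n₆ : ℕ),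
            (n₅ : ℝ) / (n₁ + n₂ + n₃ + n₄ + n₅ + n₆ : ℕ)] →
      shannonEntropy ![((n₁ : ℝ) + n₄ + n₅) / (n₁ + n₂ + n₃ + n₄ + n₅ + n₆ : ℕ),
            ((n₂ : ℝ) + n₃) / (n₁ + n₂ + n₃ + n₄ + n₅ + n₆ : ℕ),
            (n₆ : ℝ) / (n₁ + n₂ + n₃ + n₄ + n₅ + n₆ : ℕ)] ≤
          shannonEntropy ![((n₃ : ℝ) + n₅ + n₆) / (n₁ + n₂ + n₃ + n₄ + n₅ + n₆ : ℕ),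
            ((n₁ : ℝ) + n₂) / (n₁ + n₂ + n₃ + n₄ + n₅ + n₆ : ℕ),
            (n₄ : ℝ) / (n₁ + n₂ + n₃ + n₄ + n₅ + n₆ : ℕ)] →
      0 < (j : ℝ) * n₁ / (((j : ℝ) + 1) * n₃ + n₅) →
      (j : ℝ) * n₁ / (((j : ℝ) + 1) * n₃ + n₅) < 1 ∧
        ((5 * Real.log (5 / 4) + 3 * Real.log 2) / 3 - ε) *
            ((j : ℝ) * n₁ / (((j : ℝ) + 1) * n₃ + n₅) / (1 - (j : ℝ) * n₁ / (((j : ℝ) + 1) * n₃ + n₅))) ≤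
          Real.log ((1 + (((j : ℝ) + 1) * n₂ + n₁ + n₄) / (((j : ℝ) + 1) * n₃ + n₅)) /
              ((j : ℝ) * n₁ / (((j : ℝ) + 1) * n₃ + n₅))) + μ := by
  obtain ⟨τ, hτ1, hτ⟩ := twin_uniform_ceiling ε hε
  set lam : ℝ := (5 * Real.log (5 / 4) + 3 * Real.log 2) / 3 - ε with hlam
  have hlam0 : 0 < lam := by rw [hlam]; linarith
  set τ' : ℝ := max τ (1 / 2) with hτ'
  have hτ'1 : τ' < 1 := max_lt hτ1 (by norm_num)
  have hτ'0 : 0 < τ' := lt_of_lt_of_le (by norm_num) (le_max_right _ _)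
  have h1τ' : 0 < 1 - τ' := by linarith
  refine ⟨lam * (τ' / (1 - τ')), by positivity, ?_⟩
  intro j n₁ n₂ n₃ n₄ n₅ n₆ hn₆ hz₁ hz₂ hX hY ht0
  have htle := member_t_le_one j n₁ n₂ n₃ n₄ n₅ n₆ hn₆ hz₁ hz₂ hX hY
  set t : ℝ := (j : ℝ) * n₁ / (((j : ℝ) + 1) * n₃ + n₅) with htdef
  set r : ℝ := (((j : ℝ) + 1) * n₂ + n₁ + n₄) / (((j : ℝ) + 1) * n₃ + n₅) with hrdef
  have hr0 : 0 ≤ r := by rw [hrdef]; positivity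
  rcases le_or_gt t τ' with hsmall | hlarge
  · exact ⟨lt_of_le_of_lt hsmall hτ'1, gauge_of_small_t hlam0.le ht0 hsmall hτ'1 hr0 le_rfl⟩
  · have hτt : τ ≤ t := le_trans (le_max_left _ _) hlarge.le
    obtain ⟨hrpos, hceil⟩ := hτ j n₁ n₂ n₃ n₄ n₅ n₆ hn₆ hz₁ hz₂ hX hY hτt
    have ht1 : t < 1 := by
      rcases lt_or_eq_of_le htle with h | h
      · exact h
      · exfalso
        have : (1 - t) * Real.log r = 0 := by rw [h]; ring
        rw [← hrdef, ← htdef] at hceil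
        linarith
    refine ⟨ht1, ?_⟩
    exact gauge_of_ceiling (μ := lam * (τ' / (1 - τ'))) hlam0.le ht0 ht1 hrpos (by positivity)
      (by rw [← hrdef, ← htdef] at hceil; exact hceil)

/-! ## 3. The landed twin family: gauge slope exactly `(47/30) log 2` -/

/-- `t_j/(1 − t_j) = j(30j+20)/(47j+37)`. [folklore] -/
theorem fT_div_one_sub (j : ℕ) : fT j / (1 - fT j) = (j : ℝ) * (30 * j + 20) / (47 * j + 37) := by
  rw [one_sub_fT, fT_eq]
  have h1 : (0 : ℝ) < ((j : ℝ) + 1) * (30 * j + 37) := by positivity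
  have h2 : (0 : ℝ) < 47 * (j : ℝ) + 37 := by positivity
  field_simp

/-- `(47/30)·t_j/(1−t_j) ≤ j` (`47(30j+20) ≤ 30(47j+37)`). [folklore] -/
theorem family_slope_le (j : ℕ) : (47 : ℝ) / 30 * (fT j / (1 - fT j)) ≤ j := by
  rw [fT_div_one_sub]
  have h2 : (0 : ℝ) < 47 * (j : ℝ) + 37 := by positivity
  rw [mul_div_assoc', div_le_iff₀ h2]
  nlinarith [(Nat.cast_nonneg j : (0 : ℝ) ≤ j)]

/-- `2^j ≤ 1 + r_j` for `j ≥ 4` (`r_j ≥ (40j·2^j − 30j − 37)/(30j+37) ≥ 2^j − 1`). [folklore] -/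
theorem two_pow_le_one_add_fR (j : ℕ) (hj : 4 ≤ j) : (2 : ℝ) ^ j ≤ 1 + fR j := by
  rw [fR_eq j (by omega)]
  have hj' : (4 : ℝ) ≤ j := by exact_mod_cast hj
  have hD : (0 : ℝ) < ((j : ℝ) + 1) * (30 * j + 37) := by positivity
  rw [← sub_le_iff_le_add', le_div_iff₀ hD]
  have hP : (0 : ℝ) ≤ (2 : ℝ) ^ j := by positivity
  have e : (2 : ℝ) ^ (j + 1) = 2 * 2 ^ j := by ring
  rw [e]
  nlinarith [mul_nonneg (mul_nonneg (by linarith : (0 : ℝ) ≤ (j : ℝ) + 1) (by linarith : (0 : ℝ) ≤ 10 * (j : ℝ) - 37)) hP]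

/-- **The landed family is in `G_{(47/30) log 2, μ}` for every `μ ≥ 0`** (`j ≥ 4`): `(47/30) log 2 · t_j/(1−t_j) ≤ j log 2 ≤
log(1 + r_j) ≤ log((1+r_j)/t_j)`. [cite: CoppersmithWinograd1990, §8 (pp. 268–269); AlmanDuanVassilevskaWilliamsXuXuZhou2025, Thm. 3.2 and §3.4] -/
theorem twinFamily_gauge (j : ℕ) (hj : 4 ≤ j) {μ : ℝ} (hμ : 0 ≤ μ) :
    fT j < 1 ∧ (47 / 30 * Real.log 2) * (fT j / (1 - fT j)) ≤ Real.log ((1 + fR j) / fT j) + μ := by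
  refine ⟨fT_lt_one j, ?_⟩
  have hl2 : 0 < Real.log 2 := Real.log_pos one_lt_two
  have ht0 : 0 < fT j := by
    rw [fT_eq]
    have : (1 : ℝ) ≤ j := by exact_mod_cast (by omega : 1 ≤ j)
    positivity
  have ht1 := fT_lt_one j
  have h1 : (47 / 30 * Real.log 2) * (fT j / (1 - fT j)) ≤ (j : ℝ) * Real.log 2 := by
    have := mul_le_mul_of_nonneg_right (family_slope_le j) hl2.le
    linarith [this]
  have hP : (0 : ℝ) < (2 : ℝ) ^ j := by positivity
  have h2 : (j : ℝ) * Real.log 2 ≤ Real.log (1 + fR j) := by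
    rw [← Real.log_pow]
    exact Real.log_le_log hP (two_pow_le_one_add_fR j hj)
  have hr1 := one_le_fR j (by omega)
  have h3 : Real.log (1 + fR j) ≤ Real.log ((1 + fR j) / fT j) := by
    apply Real.log_le_log (by linarith)
    rw [le_div_iff₀ ht0]
    nlinarith [mul_le_mul_of_nonneg_left ht1.le (by linarith : (0 : ℝ) ≤ 1 + fR j)]
  linarith

/-- **… and outside `G_{λ,μ}` eventually, for every slope `λ > (47/30) log 2` and every level `μ`** (`1/(1−t_j) ≥ 30j/47`
by `nat_le_family_exponent`, `r_j ≤ 2^{j+1}`, `t_j ≥ 1/2`): the slope of the landed family is exactly `log θ_F`,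
`θ_F = 2^{47/30}`.  With `λ = log 4`: the family is outside gen 28's floor class `F = G_{log 4, 1 − log 2}`. [folklore] -/
theorem twinFamily_gauge_exit (lam μ : ℝ) (hlam : 47 / 30 * Real.log 2 < lam) :
    ∃ j₀ : ℕ, ∀ j : ℕ, j₀ ≤ j → ¬ (lam * (fT j / (1 - fT j)) ≤ Real.log ((1 + fR j) / fT j) + μ) := by
  have hl2 : 0 < Real.log 2 := Real.log_pos one_lt_two
  have hl2' := Real.log_two_lt_d9
  -- slack per unit of `j`
  set ε : ℝ := lam * 30 / 47 - Real.log 2 with hε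
  have hε0 : 0 < ε := by
    rw [hε]
    have : 47 / 30 * Real.log 2 * 30 / 47 = Real.log 2 := by ring
    nlinarith
  have hlam0 : 0 < lam := by nlinarith
  obtain ⟨j₀, hj₀⟩ := exists_nat_gt ((lam + 3 * Real.log 2 + |μ|) / ε + 4)
  refine ⟨j₀, fun j hj hG => ?_⟩
  have hjR : ((lam + 3 * Real.log 2 + |μ|) / ε + 4 : ℝ) < j := lt_of_lt_of_le hj₀ (by exact_mod_cast hj)
  have hj4R : (4 : ℝ) ≤ j := by
    have : 0 ≤ (lam + 3 * Real.log 2 + |μ|) / ε := by positivity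
    linarith
  have hj4 : 4 ≤ j := by exact_mod_cast hj4R
  have ht1 := fT_lt_one j
  have hs : 0 < 1 - fT j := by linarith
  -- lower bound on the left side: `λ·t/(1−t) = λ/(1−t) − λ ≥ λ·30j/47 − λ`
  have hinv : (30 : ℝ) / 47 * j ≤ 1 / (1 - fT j) := by
    have := nat_le_family_exponent j
    nlinarith
  have hL : lam * (30 / 47 * (j : ℝ)) - lam ≤ lam * (fT j / (1 - fT j)) := by
    have e : fT j / (1 - fT j) = 1 / (1 - fT j) - 1 := by field_simp; ring
    rw [e]; nlinarith
  -- upper bound on the right side: `t_j ≥ 1/2`, `1 + r_j ≤ 2^{j+2}`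
  have ht12 : 1 / 2 ≤ fT j := by
    rw [fT_eq, le_div_iff₀ (by positivity)]
    nlinarith
  have hr := fR_le j (by omega)
  have ht0 : 0 < fT j := by linarith
  have hq : (1 + fR j) / fT j ≤ (2 : ℝ) ^ (j + 3) := by
    rw [div_le_iff₀ ht0]
    have e : (2 : ℝ) ^ (j + 3) = 4 * 2 ^ (j + 1) := by ring
    have h1 : (1 : ℝ) ≤ 2 ^ (j + 1) := one_le_pow₀ (by norm_num)
    nlinarith
  have hq0 : 0 < (1 + fR j) / fT j := by
    have := one_le_fR j (by omega); positivity
  have hR : Real.log ((1 + fR j) / fT j) ≤ ((j : ℝ) + 3) * Real.log 2 := by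
    have := Real.log_le_log hq0 hq
    rw [Real.log_pow] at this; push_cast at this; linarith
  have hμ : μ ≤ |μ| := le_abs_self μ
  -- combine: `j·ε ≤ λ + 3 log 2 + |μ|`, contradiction with the choice of `j`
  have hcomb : (j : ℝ) * ε ≤ lam + 3 * Real.log 2 + |μ| := by
    rw [hε]; nlinarith
  have : (j : ℝ) ≤ (lam + 3 * Real.log 2 + |μ|) / ε := by
    rw [le_div_iff₀ hε0]; linarith
  linarith

/-- In particular the landed twin family leaves gen 28's floor class `F = G_{log 4, 1 − log 2}` (`log 4 = 2 log 2 >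
(47/30) log 2`): the class `𝒞` of gen 28 is a proper part of the tree's catalogue. [folklore] -/
theorem twinFamily_exits_lengthFloor (μ : ℝ) :
    ∃ j₀ : ℕ, ∀ j : ℕ, j₀ ≤ j → ¬ (Real.log 4 * (fT j / (1 - fT j)) ≤ Real.log ((1 + fR j) / fT j) + μ) := by
  refine twinFamily_gauge_exit (Real.log 4) μ ?_
  rw [show (4 : ℝ) = 2 ^ 2 by norm_num, Real.log_pow]; push_cast
  nlinarith [Real.log_pos one_lt_two]

/-! ## 4. X-perfect and near-square formats in every cone of slope `≤ log 4` -/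

/-- **Every X-perfect format lies in `G_{λ,μ}`** for `λ ≤ log 4`, `μ ≥ 1 − log 2` (gen 27 `xPerfect_lengthFloor` + `gauge_of_lengthFloor`).
[cite: CoppersmithWinograd1990, §8 (pp. 268–269); AlmanDuanVassilevskaWilliamsXuXuZhou2025, Thm. 3.2] -/
theorem xPerfect_gauge {lam μ : ℝ} (hlam : lam ≤ Real.log 4) (hμ : 1 - Real.log 2 ≤ μ) (q a b c : ℕ) (hq : 2 ≤ q)
    (hb : 1 ≤ b) (hqb : q * b = a + c)
    (hent : 2 * Real.negMulLog (1 / ((q : ℝ) + 2)) + Real.negMulLog (1 - 2 * (1 / ((q : ℝ) + 2))) ≤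
      Real.binEntropy (((a : ℝ) + b) / (((q : ℝ) + 2) * b))) :
    b < a ∧ lam * ((b : ℝ) / ((a : ℝ) - b)) ≤ Real.log (((a : ℝ) + c) / b) + μ := by
  obtain ⟨hlt, -, hF⟩ := xPerfect_lengthFloor q a b c hq hb hqb hent
  exact gauge_of_lengthFloor hlam hμ hb ⟨hlt, hF⟩

/-- **The near-square family `(a,b,a)`, `7b ≤ 2a`, lies in `G_{λ,μ}`** for `λ ≤ log 4`, `μ ≥ 1 − log 2`. [cite: LottiRomani1983, §1 (p. 173)] -/
theorem nearSquare_gauge {lam μ : ℝ} (hlam : lam ≤ Real.log 4) (hμ : 1 - Real.log 2 ≤ μ) {a b : ℕ} (hb : 1 ≤ b)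
    (hab : 7 * b ≤ 2 * a) :
    b < a ∧ lam * ((b : ℝ) / ((a : ℝ) - b)) ≤ Real.log (((a : ℝ) + a) / b) + μ :=
  gauge_of_lengthFloor hlam hμ hb (lengthFloor_nearSquare hb hab)

/-! ## 5. Headline: the in-class constant of the full format algebra is `c₂`, two-sided -/

/-- `c₂ < log 4` (`3125/128 < 64`). [folklore] -/
theorem classCeiling_lt_log_four : (5 * Real.log (5 / 4) + 3 * Real.log 2) / 3 < Real.log 4 := by
  have e : 5 * Real.log (5 / 4) + 3 * Real.log 2 = Real.log (3125 / 128) := three_classCeiling_eq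
  have h64 : Real.log (3125 / 128) < Real.log 64 := Real.log_lt_log (by norm_num) (by norm_num)
  have e64 : Real.log 64 = 3 * Real.log 4 := by
    rw [show (64 : ℝ) = 4 ^ 3 by norm_num, Real.log_pow]; push_cast; ring
  linarith

/-- **HEADLINE.**  Let `c₂ = (5 log(5/4) + 3 log 2)/3`.  (i) For every `c > c₂` the `SubexpSaturation` clause at rate `c` is
a theorem.  (ii) For every `0 < c < c₂` there are `μ ≥ 0` and `t₀ < 1` such that the ONE gauge cone `G = G_{(c+c₂)/2, μ}` —
closed under Kronecker sums, scalings, exact and small-defect single-base transfers (`gauge_add`, `gauge_smul`,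
`gauge_transfer`, `gauge_of_smallDefect`) — contains every STAGE-2 twin design of positive thinness, every X-perfect format and
the near-square family, and NO member `(1,t,r)` of `G` with `t ≥ t₀` is a witness of the clause at rate `c`
(`r > e^{c/(1−t)}`).  The saturation constant of the format algebra over the tree's certificate classes is exactly `c₂`.
[cite: CoppersmithWinograd1990, §8 (pp. 268–269); AlmanDuanVassilevskaWilliamsXuXuZhou2025, Thm. 3.2 and §3.4; LottiRomani1983, §1 (p. 173)] -/
theorem treeClasses_constant (c : ℝ) (hc : 0 < c) :
    ((5 * Real.log (5 / 4) + 3 * Real.log 2) / 3 < c →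
      ∃ t₀ : ℝ, t₀ < 1 ∧ ∀ t : ℝ, t₀ ≤ t → t < 1 →
        ∃ r : ℝ, 1 ≤ r ∧ r ≤ Real.exp (c / (1 - t)) ∧ omegaRect ℂ 1 t r ≤ 1 + r) ∧
    (c < (5 * Real.log (5 / 4) + 3 * Real.log 2) / 3 →
      ∃ μ t₀ : ℝ, 0 ≤ μ ∧ t₀ < 1 ∧
        -- the twin class is in `G_{(c+c₂)/2, μ}`
        (∀ (j n₁ n₂ n₃ n₄ n₅ n₆ : ℕ), 0 < n₆ → n₁ + n₄ + n₅ = 2 * n₆ → n₂ + n₃ = 2 ^ (j + 1) * n₆ →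
          shannonEntropy ![((n₁ : ℝ) + n₄ + n₅) / (n₁ + n₂ + n₃ + n₄ + n₅ + n₆ : ℕ),
                ((n₂ : ℝ) + n₃) / (n₁ + n₂ + n₃ + n₄ + n₅ + n₆ : ℕ),
                (n₆ : ℝ) / (n₁ + n₂ + n₃ + n₄ + n₅ + n₆ : ℕ)] ≤
              shannonEntropy ![((n₂ : ℝ) + n₄ + n₆) / (n₁ + n₂ + n₃ + n₄ + n₅ + n₆ : ℕ),
                ((n₁ : ℝ) + n₃) / (n₁ + n₂ + n₃ + n₄ + n₅ + n₆ : ℕ),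
                (n₅ : ℝ) / (n₁ + n₂ + n₃ + n₄ + n₅ + n₆ : ℕ)] →
          shannonEntropy ![((n₁ : ℝ) + n₄ + n₅) / (n₁ + n₂ + n₃ + n₄ + n₅ + n₆ : ℕ),
                ((n₂ : ℝ) + n₃) / (n₁ + n₂ + n₃ + n₄ + n₅ + n₆ : ℕ),
                (n₆ : ℝ) / (n₁ + n₂ + n₃ + n₄ + n₅ + n₆ : ℕ)] ≤
              shannonEntropy ![((n₃ : ℝ) + n₅ + n₆) / (n₁ + n₂ + n₃ + n₄ + n₅ + n₆ : ℕ),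
                ((n₁ : ℝ) + n₂) / (n₁ + n₂ + n₃ + n₄ + n₅ + n₆ : ℕ),
                (n₄ : ℝ) / (n₁ + n₂ + n₃ + n₄ + n₅ + n₆ : ℕ)] →
          0 < (j : ℝ) * n₁ / (((j : ℝ) + 1) * n₃ + n₅) →
          (j : ℝ) * n₁ / (((j : ℝ) + 1) * n₃ + n₅) < 1 ∧
            ((c + (5 * Real.log (5 / 4) + 3 * Real.log 2) / 3) / 2) *
                ((j : ℝ) * n₁ / (((j : ℝ) + 1) * n₃ + n₅) / (1 - (j : ℝ) * n₁ / (((j : ℝ) + 1) * n₃ + n₅))) ≤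
              Real.log ((1 + (((j : ℝ) + 1) * n₂ + n₁ + n₄) / (((j : ℝ) + 1) * n₃ + n₅)) /
                  ((j : ℝ) * n₁ / (((j : ℝ) + 1) * n₃ + n₅))) + μ) ∧
        -- the X-perfect catalogue is in `G_{(c+c₂)/2, μ}`
        (∀ q a b k : ℕ, 2 ≤ q → 1 ≤ b → q * b = a + k →
          2 * Real.negMulLog (1 / ((q : ℝ) + 2)) + Real.negMulLog (1 - 2 * (1 / ((q : ℝ) + 2))) ≤
            Real.binEntropy (((a : ℝ) + b) / (((q : ℝ) + 2) * b)) →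
          b < a ∧ ((c + (5 * Real.log (5 / 4) + 3 * Real.log 2) / 3) / 2) * ((b : ℝ) / ((a : ℝ) - b)) ≤
            Real.log (((a : ℝ) + k) / b) + μ) ∧
        -- the near-square family is in `G_{(c+c₂)/2, μ}`
        (∀ a b : ℕ, 1 ≤ b → 7 * b ≤ 2 * a →
          b < a ∧ ((c + (5 * Real.log (5 / 4) + 3 * Real.log 2) / 3) / 2) * ((b : ℝ) / ((a : ℝ) - b)) ≤
            Real.log (((a : ℝ) + a) / b) + μ) ∧
        -- no member of `G_{(c+c₂)/2, μ}` beyond `t₀` is a witness at rate `c`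
        (∀ t r : ℝ, t₀ ≤ t → t < 1 → 0 < r →
          ((c + (5 * Real.log (5 / 4) + 3 * Real.log 2) / 3) / 2) * (t / (1 - t)) ≤ Real.log ((1 + r) / t) + μ →
            Real.exp (c / (1 - t)) < r)) := by
  refine ⟨fun h => clause_above_classCeiling c h, fun h => ?_⟩
  -- `ε = (c₂ − c)/2`, slope `c₂ − ε = (c + c₂)/2`, level `μ = max(μ(ε), 1 − log 2)`
  have hε : 0 < ((5 * Real.log (5 / 4) + 3 * Real.log 2) / 3 - c) / 2 := by linarith
  have hεc : ((5 * Real.log (5 / 4) + 3 * Real.log 2) / 3 - c) / 2 < (5 * Real.log (5 / 4) + 3 * Real.log 2) / 3 := by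
    linarith
  obtain ⟨μ₁, hμ₁, hT⟩ := twinClass_gauge _ hε hεc
  have hl4 : (c + (5 * Real.log (5 / 4) + 3 * Real.log 2) / 3) / 2 ≤ Real.log 4 := by
    have := classCeiling_lt_log_four; linarith
  obtain ⟨t₀, ht₀1, hex⟩ := gaugeClass_excludes_subexp_witness ((c + (5 * Real.log (5 / 4) + 3 * Real.log 2) / 3) / 2)
    (max μ₁ (1 - Real.log 2)) c hc (by linarith)
  refine ⟨max μ₁ (1 - Real.log 2), t₀, le_trans hμ₁ (le_max_left _ _), ht₀1, ?_, ?_, ?_, hex⟩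
  · intro j n₁ n₂ n₃ n₄ n₅ n₆ hn₆ hz₁ hz₂ hX hY ht0
    obtain ⟨ht1, hG⟩ := hT j n₁ n₂ n₃ n₄ n₅ n₆ hn₆ hz₁ hz₂ hX hY ht0
    refine ⟨ht1, ?_⟩
    have e : (5 * Real.log (5 / 4) + 3 * Real.log 2) / 3 - ((5 * Real.log (5 / 4) + 3 * Real.log 2) / 3 - c) / 2 =
        (c + (5 * Real.log (5 / 4) + 3 * Real.log 2) / 3) / 2 := by ring
    rw [e] at hG
    have hμμ : μ₁ ≤ max μ₁ (1 - Real.log 2) := le_max_left _ _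
    linarith
  · intro q a b k hq hb hqb hent
    exact xPerfect_gauge hl4 (le_max_right _ _) q a b k hq hb hqb hent
  · intro a b hb hab
    exact nearSquare_gauge hl4 (le_max_right _ _) hb hab

end Summit.MatrixMultiplication.MatrixMultiplication.Theorems.SaturationLadderGaugeConeClasses

end
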